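import Mathlib.Analysis.Real.Pi.Bounds
import Mathlib.Tactic.Ring
import Mathlib.Tactic.Positivity
import Mathlib.Tactic.GCongr
import Mathlib.Algebra.BigOperators.Fin

/-!
# Stub `stub_pseudotensorBound` (line `sublinear-is-free-clean-window-charges`), part 6:
# bounds for the quadratic parts

Helper file for `stmt-FinalStateConjecture-10166` (crux `InertialRecession`). In the `2`-jet variables
of part 5 (`D = det`, `u = g⁻¹`, `d = ∂g`), assuming `|u i j| ≤ 2` and `|d a i j| ≤ b` (which part 1
derives from `‖g x − η‖ ≤ 1/2` and `‖Dg(x) v‖ ≤ b‖v‖`), every quadratic part of parts 3–5 is bounded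
by an explicit constant times `b²` (times `|D|` for the `H`-side): term-by-term triangle inequalities
mirroring the expressions, `|Σ_{i<4} fᵢ| ≤ 4M`, `|xy| ≤ AB`. With `|D| ≤ 243/2` and `π > 3` the
surviving density `−Σ_α (16π)⁻¹ Σ_β QUAD − (8π)⁻¹ D GQUAD` of part 5 is at most `7713792 · b²`
(`abs_density_le`) — the constant `C` of the stub (Landau–Lifshitz (96.9) in bound form).
-/

set_option linter.unusedSimpArgs false
set_option maxRecDepth 16384

namespace Summit.FinalStateConjecture.FinalStateConjecture.Theorems.SublinearIsFree.PseudotensorBound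

set_option linter.dupNamespace false

/-! ### Elementary inequalities -/

/-- `|Σ_{i<4} fᵢ| ≤ 4 M` if `|fᵢ| ≤ M`. [folklore] -/
private theorem abs_sum_le_four_mul {f : Fin 4 → ℝ} {M : ℝ} (h : ∀ i, |f i| ≤ M) : |∑ i, f i| ≤ 4 * M :=
  (Finset.abs_sum_le_sum_abs _ _).trans <| (Finset.sum_le_sum fun i _ ↦ h i).trans <| by simp

/-- `|xy| ≤ AB` if `|x| ≤ A`, `|y| ≤ B`. [folklore] -/
private theorem abs_mul_le_mul {x y A B : ℝ} (hx : |x| ≤ A) (hy : |y| ≤ B) : |x * y| ≤ A * B := by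
  rw [abs_mul]; exact mul_le_mul hx hy (abs_nonneg _) ((abs_nonneg _).trans hx)

/-- `|x + y| ≤ A + B`. [folklore] -/
private theorem abs_add_le_of {x y A B : ℝ} (hx : |x| ≤ A) (hy : |y| ≤ B) : |x + y| ≤ A + B :=
  (abs_add_le x y).trans (add_le_add hx hy)

/-- `|x − y| ≤ A + B`. [folklore] -/
private theorem abs_sub_le_of {x y A B : ℝ} (hx : |x| ≤ A) (hy : |y| ≤ B) : |x - y| ≤ A + B :=
  (abs_sub x y).trans (add_le_add hx hy)

/-- `|−x| ≤ A`. [folklore] -/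
private theorem abs_neg_le_of {x A : ℝ} (hx : |x| ≤ A) : |-x| ≤ A := by rwa [abs_neg]

/-- `|½| ≤ ½`. [folklore] -/
private theorem abs_half_le : |(2⁻¹ : ℝ)| ≤ 2⁻¹ := by norm_num

/-- `|½ x| ≤ ½ A`. [folklore] -/
private theorem abs_half_mul_le {x A : ℝ} (hx : |x| ≤ A) : |2⁻¹ * x| ≤ 2⁻¹ * A := by
  rw [abs_mul, abs_of_pos (by norm_num : (0 : ℝ) < 2⁻¹)]; gcongr

/-- `|(16π)⁻¹| ≤ 1/48` (`π > 3`). [folklore] -/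
private theorem abs_inv_sixteen_pi_le : |(16 * Real.pi)⁻¹| ≤ 1 / 48 := by
  have hπ := Real.pi_gt_three
  rw [abs_of_pos (by positivity), inv_eq_one_div, div_le_div_iff₀ (by positivity) (by norm_num)]
  linarith

/-- `|(8π)⁻¹| ≤ 1/24` (`π > 3`). [folklore] -/
private theorem abs_inv_eight_pi_le : |(8 * Real.pi)⁻¹| ≤ 1 / 24 := by
  have hπ := Real.pi_gt_three
  rw [abs_of_pos (by positivity), inv_eq_one_div, div_le_div_iff₀ (by positivity) (by norm_num)]
  linarith

/-! ### Bounds for the pieces of the `2`-jet expansion -/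

variable (D : ℝ) (u : Fin 4 → Fin 4 → ℝ) (d : Fin 4 → Fin 4 → Fin 4 → ℝ) {b : ℝ}

/-- `|Σ g^{ρσ}∂_a g_{σρ}| ≤ 32 b`. [cite: LandauLifshitz1975, §96 (96.9)] -/
theorem abs_trace_le (hu : ∀ i j, |u i j| ≤ 2) (hd : ∀ a i j, |d a i j| ≤ b) (a : Fin 4) :
    |∑ t1, ∑ t2, u t1 t2 * d a t2 t1|
      ≤ 32 * b :=
  le_trans
    (abs_sum_le_four_mul fun t1 ↦ (abs_sum_le_four_mul fun t2 ↦ (abs_mul_le_mul (hu t1 t2) (hd a t2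
      t1))))
    (le_of_eq (by ring))

/-- `|(g⁻¹ ∂_a g g⁻¹)_{ij}| ≤ 64 b`. [cite: LandauLifshitz1975, §96 (96.9)] -/
theorem abs_inv_le (hu : ∀ i j, |u i j| ≤ 2) (hd : ∀ a i j, |d a i j| ≤ b) (a i j : Fin 4) :
    |∑ v1, ∑ v2, u i v1 * u v2 j * d a v1 v2|
      ≤ 64 * b :=
  le_trans
    (abs_sum_le_four_mul fun v1 ↦ (abs_sum_le_four_mul fun v2 ↦ (abs_mul_le_mul (abs_mul_le_mul (hu
      i v1) (hu v2 j)) (hd a v1 v2))))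
    (le_of_eq (by ring))

/-- `|g^{μν}g^{βα} − g^{βν}g^{μα}| ≤ 8`. [cite: LandauLifshitz1975, §96 (96.9)] -/
theorem abs_minor_le (hu : ∀ i j, |u i j| ≤ 2) (μ ν α β : Fin 4) :
    |u μ ν * u β α - u β ν * u μ α|
      ≤ 8 :=
  le_trans
    (abs_sub_le_of (abs_mul_le_mul (hu μ ν) (hu β α)) (abs_mul_le_mul (hu β ν) (hu μ α)))
    (le_of_eq (by norm_num))

/-- The first-derivative piece of `∂H` is at most `512 b`. [cite: LandauLifshitz1975, §96 (96.9)] -/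
theorem abs_QQ_le (hu : ∀ i j, |u i j| ≤ 2) (hd : ∀ a i j, |d a i j| ≤ b) (μ ν α β a : Fin 4) :
    |(∑ v1, ∑ v2, u μ v1 * u v2 ν * d a v1 v2) * u β α + u μ ν * (∑ v1, ∑ v2, u β v1 * u v2 α * d a
      v1 v2) - (∑ v1, ∑ v2, u β v1 * u v2 ν * d a v1 v2) * u μ α - u β ν * (∑ v1, ∑ v2, u μ v1 * u
      v2 α * d a v1 v2)|
      ≤ 512 * b :=
  le_trans
    (abs_sub_le_of (abs_sub_le_of (abs_add_le_of (abs_mul_le_mul (abs_inv_le u d hu hd a μ ν) (hu β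
      α)) (abs_mul_le_mul (hu μ ν) (abs_inv_le u d hu hd a β α))) (abs_mul_le_mul (abs_inv_le u d hu
      hd a β ν) (hu μ α))) (abs_mul_le_mul (hu β ν) (abs_inv_le u d hu hd a μ α)))
    (le_of_eq (by ring))

/-- The quadratic part of `∂_α Σ g^{ρσ}∂_β g_{σρ}` is at most `1024 b²`. [cite: LandauLifshitz1975, §96 (96.9)] -/
theorem abs_Tquad_le (hu : ∀ i j, |u i j| ≤ 2) (hd : ∀ a i j, |d a i j| ≤ b) (α β : Fin 4) :
    |∑ t1, ∑ t2, -((∑ v1, ∑ v2, u t1 v1 * u v2 t2 * d α v1 v2) * d β t2 t1)|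
      ≤ 1024 * b ^ 2 :=
  le_trans
    (abs_sum_le_four_mul fun t1 ↦ (abs_sum_le_four_mul fun t2 ↦ (abs_neg_le_of (abs_mul_le_mul
      (abs_inv_le u d hu hd α t1 t2) (hd β t2 t1)))))
    (le_of_eq (by ring))

/-- The quadratic part of `∂_α (g⁻¹ ∂_β g g⁻¹)_{ij}` is at most `4096 b²`. [cite: LandauLifshitz1975, §96 (96.9)] -/
theorem abs_Wquad_le (hu : ∀ i j, |u i j| ≤ 2) (hd : ∀ a i j, |d a i j| ≤ b) (α β i j : Fin 4) :
    |∑ w1, ∑ w2, (-((∑ v1, ∑ v2, u i v1 * u v2 w1 * d α v1 v2) * u w2 j * d β w1 w2) - u i w1 * (∑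
      v1, ∑ v2, u w2 v1 * u v2 j * d α v1 v2) * d β w1 w2)|
      ≤ 4096 * b ^ 2 :=
  le_trans
    (abs_sum_le_four_mul fun w1 ↦ (abs_sum_le_four_mul fun w2 ↦ (abs_sub_le_of (abs_neg_le_of
      (abs_mul_le_mul (abs_mul_le_mul (abs_inv_le u d hu hd α i w1) (hu w2 j)) (hd β w1 w2)))
      (abs_mul_le_mul (abs_mul_le_mul (hu i w1) (abs_inv_le u d hu hd α w2 j)) (hd β w1 w2)))))
    (le_of_eq (by ring))

/-- The quadratic part of `∂_α` of the first-derivative piece of `∂_β H` is at most `49152 b²`. [cite: LandauLifshitz1975, §96 (96.9)] -/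
theorem abs_DQquad_le (hu : ∀ i j, |u i j| ≤ 2) (hd : ∀ a i j, |d a i j| ≤ b) (μ ν α β : Fin 4) :
    |(∑ w1, ∑ w2, (-((∑ v1, ∑ v2, u μ v1 * u v2 w1 * d α v1 v2) * u w2 ν * d β w1 w2) - u μ w1 * (∑
      v1, ∑ v2, u w2 v1 * u v2 ν * d α v1 v2) * d β w1 w2)) * u β α + (∑ v1, ∑ v2, u μ v1 * u v2 ν *
      d β v1 v2) * (-(∑ v1, ∑ v2, u β v1 * u v2 α * d α v1 v2)) + (-(∑ v1, ∑ v2, u μ v1 * u v2 ν * d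
      α v1 v2)) * (∑ v1, ∑ v2, u β v1 * u v2 α * d β v1 v2) + u μ ν * (∑ w1, ∑ w2, (-((∑ v1, ∑ v2, u
      β v1 * u v2 w1 * d α v1 v2) * u w2 α * d β w1 w2) - u β w1 * (∑ v1, ∑ v2, u w2 v1 * u v2 α * d
      α v1 v2) * d β w1 w2)) - (∑ w1, ∑ w2, (-((∑ v1, ∑ v2, u β v1 * u v2 w1 * d α v1 v2) * u w2 ν *
      d β w1 w2) - u β w1 * (∑ v1, ∑ v2, u w2 v1 * u v2 ν * d α v1 v2) * d β w1 w2)) * u μ α - (∑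
      v1, ∑ v2, u β v1 * u v2 ν * d β v1 v2) * (-(∑ v1, ∑ v2, u μ v1 * u v2 α * d α v1 v2)) - (-(∑
      v1, ∑ v2, u β v1 * u v2 ν * d α v1 v2)) * (∑ v1, ∑ v2, u μ v1 * u v2 α * d β v1 v2) - u β ν *
      (∑ w1, ∑ w2, (-((∑ v1, ∑ v2, u μ v1 * u v2 w1 * d α v1 v2) * u w2 α * d β w1 w2) - u μ w1 * (∑
      v1, ∑ v2, u w2 v1 * u v2 α * d α v1 v2) * d β w1 w2))|
      ≤ 49152 * b ^ 2 :=
  le_trans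
    (abs_sub_le_of (abs_sub_le_of (abs_sub_le_of (abs_sub_le_of (abs_add_le_of (abs_add_le_of
      (abs_add_le_of (abs_mul_le_mul (abs_Wquad_le u d hu hd α β μ ν) (hu β α)) (abs_mul_le_mul
      (abs_inv_le u d hu hd β μ ν) (abs_neg_le_of (abs_inv_le u d hu hd α β α)))) (abs_mul_le_mul
      (abs_neg_le_of (abs_inv_le u d hu hd α μ ν)) (abs_inv_le u d hu hd β β α))) (abs_mul_le_mul
      (hu μ ν) (abs_Wquad_le u d hu hd α β β α))) (abs_mul_le_mul (abs_Wquad_le u d hu hd α β β ν)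
      (hu μ α))) (abs_mul_le_mul (abs_inv_le u d hu hd β β ν) (abs_neg_le_of (abs_inv_le u d hu hd α
      μ α)))) (abs_mul_le_mul (abs_neg_le_of (abs_inv_le u d hu hd α β ν)) (abs_inv_le u d hu hd β μ
      α))) (abs_mul_le_mul (hu β ν) (abs_Wquad_le u d hu hd α β μ α)))
    (le_of_eq (by ring))

/-- **`|QUAD^{μν}_{αβ}| ≤ 98304 |det g| b²`** for the quadratic part of `∂_α∂_β H^{μβνα}`. [cite: LandauLifshitz1975, §96 (96.9)] -/
theorem abs_quadH_le (hu : ∀ i j, |u i j| ≤ 2) (hd : ∀ a i j, |d a i j| ≤ b) (μ ν α β : Fin 4) :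
    |(-(D * (∑ t1, ∑ t2, u t1 t2 * d α t2 t1) * (∑ t1, ∑ t2, u t1 t2 * d β t2 t1) + D * (∑ t1, ∑ t2,
      -((∑ v1, ∑ v2, u t1 v1 * u v2 t2 * d α v1 v2) * d β t2 t1)))) * (u μ ν * u β α - u β ν * u μ
      α) + D * (∑ t1, ∑ t2, u t1 t2 * d β t2 t1) * ((∑ v1, ∑ v2, u μ v1 * u v2 ν * d α v1 v2) * u β
      α + u μ ν * (∑ v1, ∑ v2, u β v1 * u v2 α * d α v1 v2) - (∑ v1, ∑ v2, u β v1 * u v2 ν * d α v1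
      v2) * u μ α - u β ν * (∑ v1, ∑ v2, u μ v1 * u v2 α * d α v1 v2)) + D * (∑ t1, ∑ t2, u t1 t2 *
      d α t2 t1) * ((∑ v1, ∑ v2, u μ v1 * u v2 ν * d β v1 v2) * u β α + u μ ν * (∑ v1, ∑ v2, u β v1
      * u v2 α * d β v1 v2) - (∑ v1, ∑ v2, u β v1 * u v2 ν * d β v1 v2) * u μ α - u β ν * (∑ v1, ∑
      v2, u μ v1 * u v2 α * d β v1 v2)) + D * ((∑ w1, ∑ w2, (-((∑ v1, ∑ v2, u μ v1 * u v2 w1 * d α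
      v1 v2) * u w2 ν * d β w1 w2) - u μ w1 * (∑ v1, ∑ v2, u w2 v1 * u v2 ν * d α v1 v2) * d β w1
      w2)) * u β α + (∑ v1, ∑ v2, u μ v1 * u v2 ν * d β v1 v2) * (-(∑ v1, ∑ v2, u β v1 * u v2 α * d
      α v1 v2)) + (-(∑ v1, ∑ v2, u μ v1 * u v2 ν * d α v1 v2)) * (∑ v1, ∑ v2, u β v1 * u v2 α * d β
      v1 v2) + u μ ν * (∑ w1, ∑ w2, (-((∑ v1, ∑ v2, u β v1 * u v2 w1 * d α v1 v2) * u w2 α * d β w1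
      w2) - u β w1 * (∑ v1, ∑ v2, u w2 v1 * u v2 α * d α v1 v2) * d β w1 w2)) - (∑ w1, ∑ w2, (-((∑
      v1, ∑ v2, u β v1 * u v2 w1 * d α v1 v2) * u w2 ν * d β w1 w2) - u β w1 * (∑ v1, ∑ v2, u w2 v1
      * u v2 ν * d α v1 v2) * d β w1 w2)) * u μ α - (∑ v1, ∑ v2, u β v1 * u v2 ν * d β v1 v2) * (-(∑
      v1, ∑ v2, u μ v1 * u v2 α * d α v1 v2)) - (-(∑ v1, ∑ v2, u β v1 * u v2 ν * d α v1 v2)) * (∑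
      v1, ∑ v2, u μ v1 * u v2 α * d β v1 v2) - u β ν * (∑ w1, ∑ w2, (-((∑ v1, ∑ v2, u μ v1 * u v2 w1
      * d α v1 v2) * u w2 α * d β w1 w2) - u μ w1 * (∑ v1, ∑ v2, u w2 v1 * u v2 α * d α v1 v2) * d β
      w1 w2)))|
      ≤ 98304 * |D| * b ^ 2 :=
  le_trans
    (abs_add_le_of (abs_add_le_of (abs_add_le_of (abs_mul_le_mul (abs_neg_le_of (abs_add_le_of
      (abs_mul_le_mul (abs_mul_le_mul (le_refl |D|) (abs_trace_le u d hu hd α)) (abs_trace_le u d hu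
      hd β)) (abs_mul_le_mul (le_refl |D|) (abs_Tquad_le u d hu hd α β)))) (abs_minor_le u hu μ ν α
      β)) (abs_mul_le_mul (abs_mul_le_mul (le_refl |D|) (abs_trace_le u d hu hd β)) (abs_QQ_le u d
      hu hd μ ν α β α))) (abs_mul_le_mul (abs_mul_le_mul (le_refl |D|) (abs_trace_le u d hu hd α))
      (abs_QQ_le u d hu hd μ ν α β β))) (abs_mul_le_mul (le_refl |D|) (abs_DQquad_le u d hu hd μ ν α
      β)))
    (le_of_eq (by ring))

/-- `|∂_p g_{ql} + ∂_q g_{lp} − ∂_l g_{pq}| ≤ 3 b`. [cite: LandauLifshitz1975, §96 (96.9)] -/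
theorem abs_K_le (hd : ∀ a i j, |d a i j| ≤ b) (p q l : Fin 4) :
    |d p q l + d q l p - d l p q|
      ≤ 3 * b :=
  le_trans
    (abs_sub_le_of (abs_add_le_of (hd p q l) (hd q l p)) (hd l p q))
    (le_of_eq (by ring))

/-- `|Γ^m_{pq}| ≤ 12 b`. [cite: LandauLifshitz1975, §96 (96.9)] -/
theorem abs_Gam_le (hu : ∀ i j, |u i j| ≤ 2) (hd : ∀ a i j, |d a i j| ≤ b) (p q m : Fin 4) :
    |2⁻¹ * (∑ l, u m l * (d p q l + d q l p - d l p q))|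
      ≤ 12 * b :=
  le_trans
    (abs_half_mul_le (abs_sum_le_four_mul fun l ↦ (abs_mul_le_mul (hu m l) (abs_K_le d hd p q l))))
    (le_of_eq (by ring))

/-- The quadratic part of `∂_c Γ^m_{pq}` is at most `384 b²`. [cite: LandauLifshitz1975, §96 (96.9)] -/
theorem abs_dGamQuad_le (hu : ∀ i j, |u i j| ≤ 2) (hd : ∀ a i j, |d a i j| ≤ b) (c p q m : Fin 4) :
    |2⁻¹ * (∑ l, -((∑ v1, ∑ v2, u m v1 * u v2 l * d c v1 v2) * (d p q l + d q l p - d l p q)))|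
      ≤ 384 * b ^ 2 :=
  le_trans
    (abs_half_mul_le (abs_sum_le_four_mul fun l ↦ (abs_neg_le_of (abs_mul_le_mul (abs_inv_le u d hu
      hd c m l) (abs_K_le d hd p q l)))))
    (le_of_eq (by ring))

/-- `|Σ_m (Γ^m_{ij}Γ^c_{cm} − Γ^m_{cj}Γ^c_{im})| ≤ 1152 b²`. [cite: LandauLifshitz1975, §96 (96.9)] -/
theorem abs_GG2_le (hu : ∀ i j, |u i j| ≤ 2) (hd : ∀ a i j, |d a i j| ≤ b) (i j c : Fin 4) :
    |∑ m, (2⁻¹ * (∑ l, u m l * (d i j l + d j l i - d l i j)) * (2⁻¹ * (∑ l, u c l * (d c m l + d m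
      l c - d l c m))) - 2⁻¹ * (∑ l, u m l * (d c j l + d j l c - d l c j)) * (2⁻¹ * (∑ l, u c l *
      (d i m l + d m l i - d l i m))))|
      ≤ 1152 * b ^ 2 :=
  le_trans
    (abs_sum_le_four_mul fun m ↦ (abs_sub_le_of (abs_mul_le_mul (abs_Gam_le u d hu hd i j m)
      (abs_Gam_le u d hu hd c m c)) (abs_mul_le_mul (abs_Gam_le u d hu hd c j m) (abs_Gam_le u d hu
      hd i m c))))
    (le_of_eq (by ring))

/-- **`|RQUAD_{ij}| ≤ 7680 b²`** for the quadratic part of the Ricci components. [cite: LandauLifshitz1975, §96 (96.9)] -/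
theorem abs_RQuad_le (hu : ∀ i j, |u i j| ≤ 2) (hd : ∀ a i j, |d a i j| ≤ b) (i j : Fin 4) :
    |∑ c, (2⁻¹ * (∑ l, -((∑ v1, ∑ v2, u c v1 * u v2 l * d c v1 v2) * (d i j l + d j l i - d l i j)))
      - 2⁻¹ * (∑ l, -((∑ v1, ∑ v2, u c v1 * u v2 l * d i v1 v2) * (d c j l + d j l c - d l c j))) +
      (∑ m, (2⁻¹ * (∑ l, u m l * (d i j l + d j l i - d l i j)) * (2⁻¹ * (∑ l, u c l * (d c m l + d
      m l c - d l c m))) - 2⁻¹ * (∑ l, u m l * (d c j l + d j l c - d l c j)) * (2⁻¹ * (∑ l, u c l *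
      (d i m l + d m l i - d l i m))))))|
      ≤ 7680 * b ^ 2 :=
  le_trans
    (abs_sum_le_four_mul fun c ↦ (abs_add_le_of (abs_sub_le_of (abs_dGamQuad_le u d hu hd c i j c)
      (abs_dGamQuad_le u d hu hd i c j c)) (abs_GG2_le u d hu hd i j c)))
    (le_of_eq (by ring))

/-- **`|GQUAD^{μν}| ≤ 737280 b²`** for the quadratic part of the Einstein components. [cite: LandauLifshitz1975, §96 (96.9)] -/
theorem abs_GQuad_le (hu : ∀ i j, |u i j| ≤ 2) (hd : ∀ a i j, |d a i j| ≤ b) (μ ν : Fin 4) :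
    |(∑ a1, ∑ a2, u μ a1 * u ν a2 * (∑ c, (2⁻¹ * (∑ l, -((∑ v1, ∑ v2, u c v1 * u v2 l * d c v1 v2) *
      (d a1 a2 l + d a2 l a1 - d l a1 a2))) - 2⁻¹ * (∑ l, -((∑ v1, ∑ v2, u c v1 * u v2 l * d a1 v1
      v2) * (d c a2 l + d a2 l c - d l c a2))) + (∑ m, (2⁻¹ * (∑ l, u m l * (d a1 a2 l + d a2 l a1 -
      d l a1 a2)) * (2⁻¹ * (∑ l, u c l * (d c m l + d m l c - d l c m))) - 2⁻¹ * (∑ l, u m l * (d c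
      a2 l + d a2 l c - d l c a2)) * (2⁻¹ * (∑ l, u c l * (d a1 m l + d m l a1 - d l a1 m)))))))) -
      2⁻¹ * u μ ν * (∑ a1, ∑ a2, u a1 a2 * (∑ c, (2⁻¹ * (∑ l, -((∑ v1, ∑ v2, u c v1 * u v2 l * d c
      v1 v2) * (d a1 a2 l + d a2 l a1 - d l a1 a2))) - 2⁻¹ * (∑ l, -((∑ v1, ∑ v2, u c v1 * u v2 l *
      d a1 v1 v2) * (d c a2 l + d a2 l c - d l c a2))) + (∑ m, (2⁻¹ * (∑ l, u m l * (d a1 a2 l + d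
      a2 l a1 - d l a1 a2)) * (2⁻¹ * (∑ l, u c l * (d c m l + d m l c - d l c m))) - 2⁻¹ * (∑ l, u m
      l * (d c a2 l + d a2 l c - d l c a2)) * (2⁻¹ * (∑ l, u c l * (d a1 m l + d m l a1 - d l a1
      m))))))))|
      ≤ 737280 * b ^ 2 :=
  le_trans
    (abs_sub_le_of (abs_sum_le_four_mul fun a1 ↦ (abs_sum_le_four_mul fun a2 ↦ (abs_mul_le_mul
      (abs_mul_le_mul (hu μ a1) (hu ν a2)) (abs_RQuad_le u d hu hd a1 a2)))) (abs_mul_le_mul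
      (abs_half_mul_le (hu μ ν)) (abs_sum_le_four_mul fun a1 ↦ (abs_sum_le_four_mul fun a2 ↦
      (abs_mul_le_mul (hu a1 a2) (abs_RQuad_le u d hu hd a1 a2))))))
    (le_of_eq (by ring))

/-- **The bound of the stub**: with `|det g| ≤ 243/2`, `|g^{ij}| ≤ 2`, `|∂g| ≤ b`, the surviving
density `−Σ_α (16π)⁻¹ Σ_β QUAD − (8π)⁻¹ (det g) GQUAD` (= `(det g) t^{μν}_LL`, parts 3–5) is at most
`7713792 b²`. [cite: LandauLifshitz1975, §96 (96.9)] -/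
theorem abs_density_le (hD : |D| ≤ 243 / 2) (hu : ∀ i j, |u i j| ≤ 2) (hd : ∀ a i j, |d a i j| ≤ b)
    (μ ν : Fin 4) :
    |-(∑ α, (16 * Real.pi)⁻¹ * ∑ β,
      (
      (-(D * (∑ t1, ∑ t2, u t1 t2 * d α t2 t1) * (∑ t1, ∑ t2, u t1 t2 * d β t2 t1) + D * (∑ t1, ∑
        t2, -((∑ v1, ∑ v2, u t1 v1 * u v2 t2 * d α v1 v2) * d β t2 t1)))) * (u μ ν * u β α - u β ν *
        u μ α) + D * (∑ t1, ∑ t2, u t1 t2 * d β t2 t1) * ((∑ v1, ∑ v2, u μ v1 * u v2 ν * d α v1 v2)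
        * u β α + u μ ν * (∑ v1, ∑ v2, u β v1 * u v2 α * d α v1 v2) - (∑ v1, ∑ v2, u β v1 * u v2 ν *
        d α v1 v2) * u μ α - u β ν * (∑ v1, ∑ v2, u μ v1 * u v2 α * d α v1 v2)) + D * (∑ t1, ∑ t2, u
        t1 t2 * d α t2 t1) * ((∑ v1, ∑ v2, u μ v1 * u v2 ν * d β v1 v2) * u β α + u μ ν * (∑ v1, ∑
        v2, u β v1 * u v2 α * d β v1 v2) - (∑ v1, ∑ v2, u β v1 * u v2 ν * d β v1 v2) * u μ α - u β ν
        * (∑ v1, ∑ v2, u μ v1 * u v2 α * d β v1 v2)) + D * ((∑ w1, ∑ w2, (-((∑ v1, ∑ v2, u μ v1 * u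
        v2 w1 * d α v1 v2) * u w2 ν * d β w1 w2) - u μ w1 * (∑ v1, ∑ v2, u w2 v1 * u v2 ν * d α v1
        v2) * d β w1 w2)) * u β α + (∑ v1, ∑ v2, u μ v1 * u v2 ν * d β v1 v2) * (-(∑ v1, ∑ v2, u β
        v1 * u v2 α * d α v1 v2)) + (-(∑ v1, ∑ v2, u μ v1 * u v2 ν * d α v1 v2)) * (∑ v1, ∑ v2, u β
        v1 * u v2 α * d β v1 v2) + u μ ν * (∑ w1, ∑ w2, (-((∑ v1, ∑ v2, u β v1 * u v2 w1 * d α v1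
        v2) * u w2 α * d β w1 w2) - u β w1 * (∑ v1, ∑ v2, u w2 v1 * u v2 α * d α v1 v2) * d β w1
        w2)) - (∑ w1, ∑ w2, (-((∑ v1, ∑ v2, u β v1 * u v2 w1 * d α v1 v2) * u w2 ν * d β w1 w2) - u
        β w1 * (∑ v1, ∑ v2, u w2 v1 * u v2 ν * d α v1 v2) * d β w1 w2)) * u μ α - (∑ v1, ∑ v2, u β
        v1 * u v2 ν * d β v1 v2) * (-(∑ v1, ∑ v2, u μ v1 * u v2 α * d α v1 v2)) - (-(∑ v1, ∑ v2, u β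
        v1 * u v2 ν * d α v1 v2)) * (∑ v1, ∑ v2, u μ v1 * u v2 α * d β v1 v2) - u β ν * (∑ w1, ∑ w2,
        (-((∑ v1, ∑ v2, u μ v1 * u v2 w1 * d α v1 v2) * u w2 α * d β w1 w2) - u μ w1 * (∑ v1, ∑ v2,
        u w2 v1 * u v2 α * d α v1 v2) * d β w1 w2)))))
    - (8 * Real.pi)⁻¹ * D *
      (
      (∑ a1, ∑ a2, u μ a1 * u ν a2 * (∑ c, (2⁻¹ * (∑ l, -((∑ v1, ∑ v2, u c v1 * u v2 l * d c v1 v2)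
        * (d a1 a2 l + d a2 l a1 - d l a1 a2))) - 2⁻¹ * (∑ l, -((∑ v1, ∑ v2, u c v1 * u v2 l * d a1
        v1 v2) * (d c a2 l + d a2 l c - d l c a2))) + (∑ m, (2⁻¹ * (∑ l, u m l * (d a1 a2 l + d a2 l
        a1 - d l a1 a2)) * (2⁻¹ * (∑ l, u c l * (d c m l + d m l c - d l c m))) - 2⁻¹ * (∑ l, u m l
        * (d c a2 l + d a2 l c - d l c a2)) * (2⁻¹ * (∑ l, u c l * (d a1 m l + d m l a1 - d l a1
        m)))))))) - 2⁻¹ * u μ ν * (∑ a1, ∑ a2, u a1 a2 * (∑ c, (2⁻¹ * (∑ l, -((∑ v1, ∑ v2, u c v1 *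
        u v2 l * d c v1 v2) * (d a1 a2 l + d a2 l a1 - d l a1 a2))) - 2⁻¹ * (∑ l, -((∑ v1, ∑ v2, u c
        v1 * u v2 l * d a1 v1 v2) * (d c a2 l + d a2 l c - d l c a2))) + (∑ m, (2⁻¹ * (∑ l, u m l *
        (d a1 a2 l + d a2 l a1 - d l a1 a2)) * (2⁻¹ * (∑ l, u c l * (d c m l + d m l c - d l c m)))
        - 2⁻¹ * (∑ l, u m l * (d c a2 l + d a2 l c - d l c a2)) * (2⁻¹ * (∑ l, u c l * (d a1 m l + d
        m l a1 - d l a1 m)))))))))| ≤ 7713792 * b ^ 2 := by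
  have hQ : ∀ α β : Fin 4,
      |(-(D * (∑ t1, ∑ t2, u t1 t2 * d α t2 t1) * (∑ t1, ∑ t2, u t1 t2 * d β t2 t1) + D * (∑ t1, ∑
        t2, -((∑ v1, ∑ v2, u t1 v1 * u v2 t2 * d α v1 v2) * d β t2 t1)))) * (u μ ν * u β α - u β ν *
        u μ α) + D * (∑ t1, ∑ t2, u t1 t2 * d β t2 t1) * ((∑ v1, ∑ v2, u μ v1 * u v2 ν * d α v1 v2)
        * u β α + u μ ν * (∑ v1, ∑ v2, u β v1 * u v2 α * d α v1 v2) - (∑ v1, ∑ v2, u β v1 * u v2 ν *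
        d α v1 v2) * u μ α - u β ν * (∑ v1, ∑ v2, u μ v1 * u v2 α * d α v1 v2)) + D * (∑ t1, ∑ t2, u
        t1 t2 * d α t2 t1) * ((∑ v1, ∑ v2, u μ v1 * u v2 ν * d β v1 v2) * u β α + u μ ν * (∑ v1, ∑
        v2, u β v1 * u v2 α * d β v1 v2) - (∑ v1, ∑ v2, u β v1 * u v2 ν * d β v1 v2) * u μ α - u β ν
        * (∑ v1, ∑ v2, u μ v1 * u v2 α * d β v1 v2)) + D * ((∑ w1, ∑ w2, (-((∑ v1, ∑ v2, u μ v1 * u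
        v2 w1 * d α v1 v2) * u w2 ν * d β w1 w2) - u μ w1 * (∑ v1, ∑ v2, u w2 v1 * u v2 ν * d α v1
        v2) * d β w1 w2)) * u β α + (∑ v1, ∑ v2, u μ v1 * u v2 ν * d β v1 v2) * (-(∑ v1, ∑ v2, u β
        v1 * u v2 α * d α v1 v2)) + (-(∑ v1, ∑ v2, u μ v1 * u v2 ν * d α v1 v2)) * (∑ v1, ∑ v2, u β
        v1 * u v2 α * d β v1 v2) + u μ ν * (∑ w1, ∑ w2, (-((∑ v1, ∑ v2, u β v1 * u v2 w1 * d α v1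
        v2) * u w2 α * d β w1 w2) - u β w1 * (∑ v1, ∑ v2, u w2 v1 * u v2 α * d α v1 v2) * d β w1
        w2)) - (∑ w1, ∑ w2, (-((∑ v1, ∑ v2, u β v1 * u v2 w1 * d α v1 v2) * u w2 ν * d β w1 w2) - u
        β w1 * (∑ v1, ∑ v2, u w2 v1 * u v2 ν * d α v1 v2) * d β w1 w2)) * u μ α - (∑ v1, ∑ v2, u β
        v1 * u v2 ν * d β v1 v2) * (-(∑ v1, ∑ v2, u μ v1 * u v2 α * d α v1 v2)) - (-(∑ v1, ∑ v2, u β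
        v1 * u v2 ν * d α v1 v2)) * (∑ v1, ∑ v2, u μ v1 * u v2 α * d β v1 v2) - u β ν * (∑ w1, ∑ w2,
        (-((∑ v1, ∑ v2, u μ v1 * u v2 w1 * d α v1 v2) * u w2 α * d β w1 w2) - u μ w1 * (∑ v1, ∑ v2,
        u w2 v1 * u v2 α * d α v1 v2) * d β w1 w2)))| ≤ 98304 * (243 / 2) * b ^ 2 :=
    fun α β ↦ (abs_quadH_le D u d hu hd μ ν α β).trans
      (mul_le_mul_of_nonneg_right (mul_le_mul_of_nonneg_left hD (by norm_num)) (sq_nonneg b))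
  refine le_trans (abs_sub_le_of (abs_neg_le_of (abs_sum_le_four_mul fun α ↦
    abs_mul_le_mul abs_inv_sixteen_pi_le (abs_sum_le_four_mul fun β ↦ hQ α β)))
    (abs_mul_le_mul (abs_mul_le_mul abs_inv_eight_pi_le hD) (abs_GQuad_le u d hu hd μ ν))) ?_
  exact le_of_eq (by ring)

/-! ### Registered sub-goal form -/

/-- Registered sub-goal form (part 6) of `abs_density_le` (the constant of the stub). [cite: LandauLifshitz1975, §96 (96.9)] -/
theorem pseudotensorBound_abs_density_le : ∀ (D : ℝ) (u : Fin 4 → Fin 4 → ℝ) (d : Fin 4 → Fin 4 → Fin 4 → ℝ) (b : ℝ), |D| ≤ 243 / 2 → (∀ i j, |u i j| ≤ 2) → (∀ a i j, |d a i j| ≤ b) → ∀ μ ν : Fin 4, |-(∑ α, (16 * Real.pi)⁻¹ * ∑ β, ((-(D * (∑ t1, ∑ t2, u t1 t2 * d α t2 t1) * (∑ t1, ∑ t2, u t1 t2 * d β t2 t1) + D * (∑ t1, ∑ t2, -((∑ v1, ∑ v2, u t1 v1 * u v2 t2 * d α v1 v2) * d β t2 t1)))) * (u μ ν * u β α - u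 β ν * u μ α) + D * (∑ t1, ∑ t2, u t1 t2 * d β t2 t1) * ((∑ v1, ∑ v2, u μ v1 * u v2 ν * d α v1 v2) * u β α + u μ ν * (∑ v1, ∑ v2, u β v1 * u v2 α * d α v1 v2) - (∑ v1, ∑ v2, u β v1 * u v2 ν * d α v1 v2) * u μ α - u β ν * (∑ v1, ∑ v2, u μ v1 * u v2 α * d α v1 v2)) + D * (∑ t1, ∑ t2, u t1 t2 * d α t2 t1) * ((∑ v1, ∑ v2, u μ v1 * u v2 ν * d β v1 v2) * u β α + u μ ν * (∑ v1, ∑ v2, u β v1 * u v2 α * d β v1 v2) - (∑ v1, ∑ v2, u β v1 * u v2 ν * d β v1 v2) * u μ α - u β ν * (∑ v1, ∑ v2, u μ v1 * u v2 α * d β v1 v2)) + D * ((∑ w1, ∑ w2, (-((∑ v1, ∑ v2, u μ v1 * u v2 w1 * d α v1 v2) * u w2 ν * d β w1 w2) - u μ w1 * (∑ v1, ∑ v2, u w2 v1 * u v2 ν * d α v1 v2) * d β w1 w2)) * u β α + (∑ v1, ∑ v2, u μ v1 * u v2 ν * d β v1 v2) * (-(∑ v1, ∑ v2, u β v1 *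 u v2 α * d α v1 v2)) + (-(∑ v1, ∑ v2, u μ v1 * u v2 ν * d α v1 v2)) * (∑ v1, ∑ v2, u β v1 * u v2 α * d β v1 v2) + u μ ν * (∑ w1, ∑ w2, (-((∑ v1, ∑ v2, u β v1 * u v2 w1 * d α v1 v2) * u w2 α * d β w1 w2) - u β w1 * (∑ v1, ∑ v2, u w2 v1 * u v2 α * d α v1 v2) * d β w1 w2)) - (∑ w1, ∑ w2, (-((∑ v1, ∑ v2, u β v1 * u v2 w1 * d α v1 v2) * u w2 ν * d β w1 w2) - u β w1 * (∑ v1, ∑ v2, u w2 v1 * u v2 ν * d α v1 v2) * d β w1 w2)) * u μ α - (∑ v1, ∑ v2, u β v1 * u v2 ν * d β v1 v2) * (-(∑ v1, ∑ v2, u μ v1 * u v2 α * d α v1 v2)) - (-(∑ v1, ∑ v2, u β v1 * u v2 ν * d α v1 v2)) * (∑ v1, ∑ v2, u μ v1 * u v2 α * d β v1 v2) - u β ν * (∑ w1, ∑ w2, (-((∑ v1, ∑ v2, u μ v1 * u v2 w1 * d α v1 v2) * u w2 α * d β w1 w2) - u μ w1 * (∑ v1, ∑ v2, u w2 v1 *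 u v2 α * d α v1 v2) * d β w1 w2))))) - (8 * Real.pi)⁻¹ * D * ((∑ a1, ∑ a2, u μ a1 * u ν a2 * (∑ c, (2⁻¹ * (∑ l, -((∑ v1, ∑ v2, u c v1 * u v2 l * d c v1 v2) * (d a1 a2 l + d a2 l a1 - d l a1 a2))) - 2⁻¹ * (∑ l, -((∑ v1, ∑ v2, u c v1 * u v2 l * d a1 v1 v2) * (d c a2 l + d a2 l c - d l c a2))) + (∑ m, (2⁻¹ * (∑ l, u m l * (d a1 a2 l + d a2 l a1 - d l a1 a2)) * (2⁻¹ * (∑ l, u c l * (d c m l + d m l c - d l c m))) - 2⁻¹ * (∑ l, u m l * (d c a2 l + d a2 l c - d l c a2)) * (2⁻¹ * (∑ l, u c l * (d a1 m l + d m l a1 - d l a1 m)))))))) - 2⁻¹ * u μ ν * (∑ a1, ∑ a2, u a1 a2 * (∑ c, (2⁻¹ * (∑ l, -((∑ v1, ∑ v2, u c v1 * u v2 l * d c v1 v2) * (d a1 a2 l + d a2 l a1 - d l a1 a2))) - 2⁻¹ * (∑ l, -((∑ v1, ∑ v2, u c v1 * u v2 l * d a1 v1 v2) * (d c a2 l +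 d a2 l c - d l c a2))) + (∑ m, (2⁻¹ * (∑ l, u m l * (d a1 a2 l + d a2 l a1 - d l a1 a2)) * (2⁻¹ * (∑ l, u c l * (d c m l + d m l c - d l c m))) - 2⁻¹ * (∑ l, u m l * (d c a2 l + d a2 l c - d l c a2)) * (2⁻¹ * (∑ l, u c l * (d a1 m l + d m l a1 - d l a1 m)))))))))| ≤ 7713792 * b ^ 2 :=
  fun D u d _ hD hu hd μ ν ↦ abs_density_le D u d hD hu hd μ ν

end Summit.FinalStateConjecture.FinalStateConjecture.Theorems.SublinearIsFree.PseudotensorBound
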